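import Literature.NumberTheory.K2Lit.DoubledTensorEmbedding      -- ★ `tensorEmb`, `tensorFrame`, `isSiegelDeltaSection_comp_tensorEmb`
import Literature.NumberTheory.K2Lit.SiegelWeilSectionLine       -- ★ `swSection`, `isSiegelDeltaSection_swSection`
import HarnessLib

/-!
# K2Lit — Siegel–Weil sections of a hermitian `M₂`-space on the doubled group (DEFS leaf O42.3b)

Topic `NumberTheory/K2Lit` (Track B, build stream 29; item of record hLiu418 = stmt-HodgeConjecture-24832; steward of socket #42R, SPEC
`SPEC-42R-RoadA-Carriers` S-B, 2026-09-04).  Definitions and proved lemmas only: **no `sorry`, no named fact, no instance, no notation.**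

For the doubled datum `(dV, dW, e)` of ★ `DoubledUnitaryGlobalSplittingData` (`H = U(𝔻)`, `n = NM`) and a diagonal hermitian `M₂`-space `V′`
(frame `dV′`), the Weil representation of the dual pair `(U(𝔻), U(V′))` is the `χ`-normalised doubled Weil representation ★ `IsDoubledWeilRep` of
the BIG datum `(dV, tensorFrame dW eW dV′, e′)` (`𝔻 ⊗ V′`, ★ `K2Lit/DoubledTensorEmbedding`) read along ★ `tensorEmb : h ↦ h ⊗ 1_{V′}`.  Its
SIEGEL–WEIL SECTIONS are therefore ★ `swSection` (of the big datum, ★ `K2Lit/SiegelWeilSectionLine`) composed with `tensorEmb`: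

* `swSectionTensor sB Φ h := swSection(big) sB Φ (tensorEmb h)`;
* **`isSiegelDeltaSection_swSectionTensor`**: for `hsB : IsDoubledWeilRep(big) χ sB`, `swSectionTensor sB Φ ∈ I((M₂ − n)/2, χ^{M₂})`
  — the Siegel–Weil point `s_{M₂,n} = (M₂ − n)/2` of an `M₂`-space [GanQiuTakeda2014 §1.10]; for `n = 2`, `M₂ = 3` this is `I(½, χ³)`, the
  space on which socket #42R takes residues (road (SPAN3)/(FTI) of the steward's memo);
* linearity in `Φ`.

Characters: the big datum's `χ` (an `IsSplittingChar L 1`-character for ★ `doubledWeilRep`) appears on `H` as `χ^{M₂}`; other characters with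
the same restriction to `𝕀_{L⁺}` are reached by a continuous automorphic twist (★ `AdelicMetaplecticTwistCharacter`, ★ `adelicMpCont.twist`) —
not typed here.  Nothing printed is asserted.  HONEST LABEL: HC_CM is proved only modulo the 7 printed citations (2 remaining named inputs:
hLiu418 = stmt-HodgeConjecture-24832, h413 = stmt-HodgeConjecture-24833) until rung 0 closes.

References: [KudlaRallis1994] §1; [HarrisKudlaSweet1996] §1 (1.8), (1.15)–(1.16); [Kudla1994] §3 Thm. 3.1; [GanQiuTakeda2014] §1.10, §7;
[Ichino2004] §1; [Liu2021] App. B p. 104.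
-/

set_option autoImplicit false
-- the doubled metaplectic carrier elaborates slowly (cf. ★ `SiegelWeilSectionLine`)
set_option maxHeartbeats 2000000

noncomputable section

open NumberField IsDedekindDomain
open scoped Matrix Kronecker

namespace Literature.NumberTheory.K2Lit.SiegelDoubled

open Literature.NumberTheory.Automorphic Literature.NumberTheory.Automorphic.UnitaryGroup Literature.NumberTheory.GaloisRepresentations
open Literature.NumberTheory.GelbartRogawski1991 Literature.NumberTheory.GelbartRogawski1991.GRConstruction
open Literature.NumberTheory.Weil1964
open Literature.RepresentationTheory.HarrisKudlaSweet1996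

variable (L : Type) [Field L] [NumberField L] [IsCMField L]
variable {N M n : ℕ} (e : Fin N × Fin M ≃ Fin n)
  (dV : Fin N → L) (hdV : ∀ i, IsCMField.complexConj L (dV i) = dV i)
  (dW : Fin M → L) (hdW : ∀ i, IsCMField.complexConj L (dW i) = dW i)
variable {M₂ M' n' : ℕ} (eW : Fin M × Fin M₂ ≃ Fin M') (e' : Fin N × Fin M' ≃ Fin n')
  (dV' : Fin M₂ → L) (hdV' : ∀ k, IsCMField.complexConj L (dV' k) = dV' k)

/-! ## 1. Siegel–Weil sections of an `M₂`-space -/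

section SWTensor

variable (hdV0 : ∀ i, dV i ≠ 0) (hdW0 : ∀ i, dW i ≠ 0) (hdV'0 : ∀ k, dV' k ≠ 0)

/-- **The Siegel–Weil section of the hermitian `M₂`-space `V′` (frame `dV′`)** attached to a homomorphism `sB : U(𝔻 ⊗ V′)(𝔸) →* Mp(𝕎^{𝔻⊗V′})ᶜᵒⁿᵗ`
and `Φ ∈ 𝒮(𝔸^{n′+n′})`: `f_Φ(h) := (ω(r_F(δ′)·sB(h ⊗ 1))Φ)(0)` = ★ `swSection` of the big datum read along `tensorEmb`.
[cite: KudlaRallis1994, §1] [cite: HarrisKudlaSweet1996, §1 (1.15)–(1.16)] -/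
def swSectionTensor
    (sB : HA L e' dV hdV (tensorFrame L dW eW dV') (tensorFrame_real L dW hdW eW dV' hdV') →*
      MpD L e' dV hdV (tensorFrame L dW eW dV') (tensorFrame_real L dW hdW eW dV' hdV'))
    (Φ : piSchwartzBruhat (Fp L) (Fin (n' + n'))) (h : HA L e dV hdV dW hdW) : ℂ :=
  swSection L e' dV hdV hdV0 (tensorFrame L dW eW dV') (tensorFrame_real L dW hdW eW dV' hdV')
    (tensorFrame_ne_zero L dW eW dV' hdW0 hdV'0) sB Φ (tensorEmb L e dV hdV dW hdW eW e' dV' hdV' h)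

/-- unfolding. [cite: KudlaRallis1994, §1] -/
theorem swSectionTensor_apply
    (sB : HA L e' dV hdV (tensorFrame L dW eW dV') (tensorFrame_real L dW hdW eW dV' hdV') →*
      MpD L e' dV hdV (tensorFrame L dW eW dV') (tensorFrame_real L dW hdW eW dV' hdV'))
    (Φ : piSchwartzBruhat (Fp L) (Fin (n' + n'))) (h : HA L e dV hdV dW hdW) :
    swSectionTensor L e dV hdV dW hdW eW e' dV' hdV' hdV0 hdW0 hdV'0 sB Φ h =
      swSection L e' dV hdV hdV0 (tensorFrame L dW eW dV') (tensorFrame_real L dW hdW eW dV' hdV')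
        (tensorFrame_ne_zero L dW eW dV' hdW0 hdV'0) sB Φ (tensorEmb L e dV hdV dW hdW eW e' dV' hdV' h) := rfl

/-- **SW sections of an `M₂`-space are Siegel sections at `s = (M₂ − n)/2` for the character `χ^{M₂}`**: for `sB` the `χ`-normalised doubled
Weil representation of the BIG datum (★ `IsDoubledWeilRep`), `swSectionTensor sB Φ ∈ I((M₂ − n)/2, χ^{M₂})` (★ `isSiegelDeltaSection_swSection`
on the big datum at `(1 − n′)/2`, restricted by `isSiegelDeltaSection_comp_tensorEmb`).  For `n = 2`, `M₂ = 3`: `I(½, χ³)` — the residue space of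
socket #42R. [cite: KudlaRallis1994, §1] [cite: HarrisKudlaSweet1996, §1 (1.15)–(1.16)] [cite: GanQiuTakeda2014, §1.10] -/
theorem isSiegelDeltaSection_swSectionTensor (hM₂ : M₂ ≠ 0) {χ : Literature.NumberTheory.GaloisRepresentations.HeckeCharacter L}
    {sB : HA L e' dV hdV (tensorFrame L dW eW dV') (tensorFrame_real L dW hdW eW dV' hdV') →*
      MpD L e' dV hdV (tensorFrame L dW eW dV') (tensorFrame_real L dW hdW eW dV' hdV')}
    (hsB : IsDoubledWeilRep L e' dV hdV hdV0 (tensorFrame L dW eW dV') (tensorFrame_real L dW hdW eW dV' hdV')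
      (tensorFrame_ne_zero L dW eW dV' hdW0 hdV'0) χ sB)
    (Φ : piSchwartzBruhat (Fp L) (Fin (n' + n'))) :
    IsSiegelDeltaSection L e dV hdV dW hdW (χ ^ M₂) (((M₂ : ℂ) - (n : ℂ)) / 2)
      (swSectionTensor L e dV hdV dW hdW eW e' dV' hdV' hdV0 hdW0 hdV'0 sB Φ) := by
  have key := isSiegelDeltaSection_comp_tensorEmb L e dV hdV dW hdW eW e' dV' hdV' hM₂
    (isSiegelDeltaSection_swSection L e' dV hdV hdV0 (tensorFrame L dW eW dV') (tensorFrame_real L dW hdW eW dV' hdV')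
      (tensorFrame_ne_zero L dW eW dV' hdW0 hdV'0) hsB Φ)
  rw [show (M₂ : ℂ) * ((1 - (n' : ℂ)) / 2) + ((M₂ : ℂ) * (n' : ℂ) - (n : ℂ)) / 2 = ((M₂ : ℂ) - (n : ℂ)) / 2 by ring] at key
  exact key

/-- linearity in `Φ` (addition). [cite: KudlaRallis1994, §1] -/
theorem swSectionTensor_add
    (sB : HA L e' dV hdV (tensorFrame L dW eW dV') (tensorFrame_real L dW hdW eW dV' hdV') →*
      MpD L e' dV hdV (tensorFrame L dW eW dV') (tensorFrame_real L dW hdW eW dV' hdV'))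
    (Φ Ψ : piSchwartzBruhat (Fp L) (Fin (n' + n'))) (h : HA L e dV hdV dW hdW) :
    swSectionTensor L e dV hdV dW hdW eW e' dV' hdV' hdV0 hdW0 hdV'0 sB (Φ + Ψ) h =
      swSectionTensor L e dV hdV dW hdW eW e' dV' hdV' hdV0 hdW0 hdV'0 sB Φ h +
        swSectionTensor L e dV hdV dW hdW eW e' dV' hdV' hdV0 hdW0 hdV'0 sB Ψ h :=
  swSection_add L e' dV hdV hdV0 _ _ _ sB Φ Ψ _

/-- linearity in `Φ` (scalars). [cite: KudlaRallis1994, §1] -/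
theorem swSectionTensor_smul
    (sB : HA L e' dV hdV (tensorFrame L dW eW dV') (tensorFrame_real L dW hdW eW dV' hdV') →*
      MpD L e' dV hdV (tensorFrame L dW eW dV') (tensorFrame_real L dW hdW eW dV' hdV'))
    (c : ℂ) (Φ : piSchwartzBruhat (Fp L) (Fin (n' + n'))) (h : HA L e dV hdV dW hdW) :
    swSectionTensor L e dV hdV dW hdW eW e' dV' hdV' hdV0 hdW0 hdV'0 sB (c • Φ) h =
      c * swSectionTensor L e dV hdV dW hdW eW e' dV' hdV' hdV0 hdW0 hdV'0 sB Φ h :=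
  swSection_smul L e' dV hdV hdV0 _ _ _ sB c Φ _

end SWTensor

end Literature.NumberTheory.K2Lit.SiegelDoubled

end
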